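import Literature.Analysis.FluidPDE.BrodingerProblem
import Literature.Analysis.FunctionSpaces.TorusTestFunction
import HarnessLib

/-!
# The scalar pressure of the Brödinger problem (Lagrange multiplier of incompressibility)

Analysis/FluidPDE definition file (interface; no existence statement, no named fact), on top of
`Literature.Analysis.FluidPDE.BrodingerProblem` (the entropic least-action problem `Brö_ν(γ)` of
Arnaudon–Cruzeiro–Léonard–Zambrini on the flat torus: path space `TorusPath d t₀ t₁`, reference
law `reversibleBrownianLaw` with generator `νΔ`, data `D : BrodingerProblem d`, `D.IsAdmissible`,
`D.entropy P = klDiv P D.reference`, `IsBrodingerMinimiser`).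

Baradat proved that, exactly as in Brenier's inviscid relaxed least-action problem (Brenier1999,
AmbrosioFigalli2008), the minimiser of the Brödinger problem comes with a **scalar pressure
field**, the Lagrange multiplier of the incompressibility constraint: a distribution `p` on
`(t₀, t₁) × T^d`, unique up to distributions depending on time only, such that for every smooth
zero-mean density perturbation `φ` compactly supported in `(t₀, t₁)` and every generalized flow `Q`
with the prescribed endpoint coupling and marginals `(1 + φ(t, ·)) Leb`,
`𝓗(Q) ≥ 𝓗(P) + ⟨p, φ⟩`, where `𝓗` is the entropy scaled to the expected kinetic action
(Baradat2020, Thm. 2; the multiphase/Euler-like momentum balance `∂ₜ(Σρc) + div(Σ(c⊗c − w⊗w)ρ)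
= −∇p`, Thm. 5, identifies `p` as the kinematic pressure).

## Main definitions

* `IsPressureTest t₀ t₁ φ`: `φ ∈ 𝒟((t₀, t₁) × T^d)` with zero spatial mean at all times.
* `BrodingerProblem.IsPerturbedFlow D φ Q`: competitors with endpoint coupling `D.coupling` and
  marginals `(1 + φ(t,·)) Leb` (for `φ = 0`: `D.IsAdmissible`, `isPerturbedFlow_zero_iff`).
* `pressurePairing t₀ t₁ p φ = ∫_{(t₀,t₁)} ∫_{T^d} p φ`.
* `HasBrodingerPressure D P p`: `p : ℝ → T^d → ℝ`, locally integrable on `(t₀, t₁) × T^d`, is a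
  Brödinger pressure of the admissible finite-entropy flow `P`:
  `⟨p, φ⟩ ≤ 2ν (H(Q | R) − H(P | R))` for all tests `φ` and all `φ`-perturbed flows `Q` of finite
  entropy (Baradat2020, Thm. 2, for a pressure represented by a function).
* API: such a `P` is the Brödinger minimiser (`HasBrodingerPressure.isBrodingerMinimiser`, test
  with `φ = 0`); gauge freedom `p ↦ p + c(t)` (`HasBrodingerPressure.add_time`); equilibrium: the
  reference law is the minimiser of its own coupling with pressure `0`
  (`hasBrodingerPressure_reversibleBrownianLaw_zero`).

## Normalisation

`BrodingerProblem` indexes the reference law by the fluid viscosity `ν` (generator `νΔ`, noise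
`√(2ν) dW`), i.e. ACLZ's diffusion coefficient `a = 2ν` and Baradat's diffusivity `2ν` (his `R^ν`
has generator `(ν/2)Δ`, Baradat2020 §4). Baradat's scaled entropy is `H̄ = a · H(· | R) = 2ν · H`,
the expected kinetic action `½ E_P ∫ |v_t|² dt` by Girsanov (ArnaudonEtAl2020 (13); Baradat2020
Thm. 9); hence the factor `2ν` in `HasBrodingerPressure`, which makes `p` the *kinematic pressure*:
ACLZ's `p' = a · p_dual` in the Navier–Stokes/Burgers equation of the backward drifts
(ArnaudonEtAl2020, Thm. 24) and in the second-order Hamilton–Jacobi–Bellman relations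
`∂ₜψ + ½|∇ψ|² ± νΔψ + p = 0` of the phase potentials (ArnaudonEtAl2020, Thms. 23–24). Theorem
numbers are those of arXiv:1704.02126 (ACLZ) and arXiv:1803.06299 (Baradat).

## Deliberately not here (facts to vendor separately)

existence and uniqueness-mod-time of the pressure and its regularity (Baradat2020 Thms. 2, 5;
inviscid analogues Brenier1999 `∇p` a locally finite measure, AmbrosioFigalli2008
`p ∈ L²_loc((0,T); BV)`); ACLZ's dual-attainment form of regular solutions
`P = exp(η(X_{t₀}, X_{t₁}) + ∫ p(t, X_t) dt − 𝒬(X_{t₀})) R` and the HJB system of the conditioned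
potentials (ArnaudonEtAl2020, Cor. 11, Thms. 23–24; needs conditioning of path measures); the
identification of the Navier–Stokes pressure of a classical solution with a Brödinger pressure of
its drift law `driftLaw ν t₀ t₁ u` on minimality windows.

## References

* A. Baradat, *On the existence of a scalar pressure field in the Brödinger problem*, SIAM J.
  Math. Anal. 52 (2020) 370–401, arXiv:1803.06299 [Baradat2020]; M. Arnaudon, A. B. Cruzeiro,
  C. Léonard, J.-C. Zambrini, AIHP PS 56 (2020), arXiv:1704.02126 [ArnaudonEtAl2020];
  Y. Brenier, CPAM 52 (1999) [Brenier1999]; L. Ambrosio, A. Figalli, ARMA 194 (2008)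
  [AmbrosioFigalli2008].
-/

noncomputable section

open MeasureTheory Set Filter Function InformationTheory Literature.Analysis.FunctionSpaces
open scoped ENNReal NNReal

namespace Literature.Analysis.FluidPDE

variable {d : Type*} [Fintype d]

/-! ## Density perturbations -/

/-- **Admissible density perturbations** `φ ∈ 𝒟((t₀, t₁) × T^d)` with zero spatial mean at all
times (Baradat2020, Thm. 2): the space–time lift `(t, y) ↦ φ t (proj y)` is `C^∞` on `ℝ × ℝ^d`,
`φ(t, ·) = 0` for `t` near or outside the endpoints (compact support in the *open* interval), and
`∫_{T^d} φ(t, x) dx = 0` for every `t`. [cite: Baradat2020, Thm. 2] -/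
structure IsPressureTest (t₀ t₁ : ℝ) (φ : ℝ → UnitAddTorus d → ℝ) : Prop where
  /-- Joint smoothness through the periodic lift (`Torus.stLift`). -/
  smooth : ContDiff ℝ (⊤ : ℕ∞) (Torus.stLift φ)
  /-- Compact support in time inside `(t₀, t₁)`. -/
  eventually_eq_zero : ∃ ε > (0 : ℝ), ∀ t, t ≤ t₀ + ε ∨ t₁ - ε ≤ t → φ t = 0
  /-- Zero spatial mean at all times (perturbed marginals stay probability measures). -/
  integral_eq_zero : ∀ t, ∫ x, φ t x = 0

/-- Slices of a pressure test are continuous. [folklore] -/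
theorem IsPressureTest.continuous_apply {t₀ t₁ : ℝ} {φ : ℝ → UnitAddTorus d → ℝ}
    (hφ : IsPressureTest t₀ t₁ φ) (t : ℝ) : Continuous (φ t) :=
  (Torus.continuous_uncurry_of_continuous_stLift hφ.smooth.continuous).uncurry_left t

/-- Slices of a pressure test are integrable over the (compact, probability) torus. [folklore] -/
theorem IsPressureTest.integrable_apply {t₀ t₁ : ℝ} {φ : ℝ → UnitAddTorus d → ℝ}
    (hφ : IsPressureTest t₀ t₁ φ) (t : ℝ) : Integrable (φ t) :=
  (hφ.continuous_apply t).integrable_of_hasCompactSupport (HasCompactSupport.of_compactSpace _)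

/-- A pressure test vanishes at and before the initial time. [folklore] -/
theorem IsPressureTest.apply_of_le {t₀ t₁ : ℝ} {φ : ℝ → UnitAddTorus d → ℝ}
    (hφ : IsPressureTest t₀ t₁ φ) {t : ℝ} (ht : t ≤ t₀) : φ t = 0 := by
  obtain ⟨ε, hε, h⟩ := hφ.eventually_eq_zero
  exact h t (Or.inl (by linarith))

/-- A pressure test vanishes at and after the final time. [folklore] -/
theorem IsPressureTest.apply_of_ge {t₀ t₁ : ℝ} {φ : ℝ → UnitAddTorus d → ℝ}
    (hφ : IsPressureTest t₀ t₁ φ) {t : ℝ} (ht : t₁ ≤ t) : φ t = 0 := by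
  obtain ⟨ε, hε, h⟩ := hφ.eventually_eq_zero
  exact h t (Or.inr (by linarith))

/-- The zero perturbation is a pressure test. [folklore] -/
theorem isPressureTest_zero (t₀ t₁ : ℝ) : IsPressureTest t₀ t₁ (0 : ℝ → UnitAddTorus d → ℝ) :=
  ⟨contDiff_const, ⟨1, one_pos, fun _ _ => rfl⟩, fun _ => by simp⟩

/-- The **pressure–perturbation pairing** `⟨p, φ⟩ = ∫_{(t₀,t₁)} ∫_{T^d} p(t,x) φ(t,x) dx dt`
(iterated Bochner integrals; meaningful for `p` locally integrable on `(t₀, t₁) × T^d` and `φ` a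
pressure test, non-integrable slices contributing `0` by the Bochner convention).
[cite: Baradat2020, Thm. 2] -/
def pressurePairing (t₀ t₁ : ℝ) (p φ : ℝ → UnitAddTorus d → ℝ) : ℝ :=
  ∫ t in Ioo t₀ t₁, ∫ x, p t x * φ t x

/-- Adding a function of time alone does not change the pairing against zero-mean tests.
[folklore] -/
theorem pressurePairing_add_time {t₀ t₁ : ℝ} {p : ℝ → UnitAddTorus d → ℝ} (c : ℝ → ℝ)
    {φ : ℝ → UnitAddTorus d → ℝ} (hφi : ∀ t, Integrable (φ t)) (hφ0 : ∀ t, ∫ x, φ t x = 0) :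
    pressurePairing t₀ t₁ (fun t x => p t x + c t) φ = pressurePairing t₀ t₁ p φ := by
  unfold pressurePairing
  congr 1; funext t
  have hc : Integrable (fun x => c t * φ t x) := (hφi t).const_mul (c t)
  by_cases hp : Integrable (fun x => p t x * φ t x)
  · simp_rw [add_mul]
    rw [integral_add hp hc, integral_const_mul, hφ0 t, mul_zero, add_zero]
  · have hsum : ¬ Integrable (fun x => (p t x + c t) * φ t x) := fun hs =>
      hp ((hs.sub hc).congr (Eventually.of_forall fun x => by simp only [Pi.sub_apply]; ring))
    rw [integral_undef hp, integral_undef hsum]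

/-! ## Perturbed competitors and the pressure -/

namespace BrodingerProblem

variable (D : BrodingerProblem d)

/-- **Competitors with perturbed density** (Baradat2020, Thm. 2): generalized flows `Q` on the
window of `D` with the prescribed endpoint coupling, `(X_{t₀}, X_{t₁})_# Q = γ`, and time marginals
`(X_t)_# Q = (1 + φ(t, ·)) Leb` for all `t ∈ [t₀, t₁]` (vacuous when `1 + φ` changes sign, as in
the source). [cite: Baradat2020, Thm. 2] -/
structure IsPerturbedFlow (φ : ℝ → UnitAddTorus d → ℝ) (Q : Measure (TorusPath d D.t₀ D.t₁)) :
    Prop where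
  /-- `Q` is a generalized flow, i.e. a probability measure on path space (so the constraint
  below is vacuous unless `1 + φ ≥ 0`, `ENNReal.ofReal` notwithstanding). -/
  isProbabilityMeasure : IsProbabilityMeasure Q
  /-- Perturbed marginals `(1 + φ(t, ·)) Leb`. -/
  map_eval : ∀ t : Icc D.t₀ D.t₁,
    Q.map (TorusPath.eval t) = volume.withDensity fun x => ENNReal.ofReal (1 + φ t x)
  /-- Endpoint constraint. -/
  map_endpoints : Q.map D.endpoints = D.coupling

/-- Perturbing by `φ = 0` gives back the admissible class. [folklore] -/
theorem isPerturbedFlow_zero_iff (Q : Measure (TorusPath d D.t₀ D.t₁)) :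
    D.IsPerturbedFlow 0 Q ↔ D.IsAdmissible Q := by
  have h1 : (volume : Measure (UnitAddTorus d)).withDensity
      (fun x => ENNReal.ofReal (1 + (0 : ℝ → UnitAddTorus d → ℝ) 0 x)) = volume := by
    simp only [Pi.zero_apply, add_zero, ENNReal.ofReal_one]; exact withDensity_one
  exact ⟨fun ⟨_, hm, he⟩ => ⟨fun t => by simpa [h1] using hm t, he⟩,
    fun h => ⟨h.isProbabilityMeasure, fun t => by simpa [h1] using h.map_eval t, h.map_endpoints⟩⟩

/-- A flow perturbed by a pressure test has the Haar marginal at the initial time (the test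
vanishes there), consistently with a bistochastic coupling. [folklore] -/
theorem IsPerturbedFlow.map_eval_start {φ : ℝ → UnitAddTorus d → ℝ}
    {Q : Measure (TorusPath d D.t₀ D.t₁)} (hQ : D.IsPerturbedFlow φ Q)
    (hφ : IsPressureTest D.t₀ D.t₁ φ) :
    Q.map (TorusPath.eval ⟨D.t₀, left_mem_Icc.2 D.le⟩) = volume := by
  rw [hQ.map_eval]
  simp only [hφ.apply_of_le le_rfl, Pi.zero_apply, add_zero, ENNReal.ofReal_one]
  exact withDensity_one

end BrodingerProblem

/-- **A scalar pressure field of the Brödinger problem** (Baradat2020, Thm. 2, for a pressure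
represented by a *function*): `p : ℝ → T^d → ℝ`, locally integrable on `(t₀, t₁) × T^d`, is a
Lagrange multiplier of the incompressibility constraint at the admissible finite-entropy flow `P`,
i.e. for every zero-mean smooth density perturbation `φ` compactly supported in `(t₀, t₁)` and
every generalized flow `Q` with endpoint coupling `γ` and marginals `(1 + φ(t,·)) Leb`,

  `2ν · H(Q | R^ν) ≥ 2ν · H(P | R^ν) + ⟨p, φ⟩`

(asked for `H(Q|R^ν) < ∞`, trivial otherwise; the factor `2ν` makes `p` the kinematic pressure, see the module
docstring). Such a `P` is automatically the minimiser (`HasBrodingerPressure.isBrodingerMinimiser`)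
and `p` matters only modulo functions of time (`HasBrodingerPressure.add_time`; uniqueness modulo
those, and existence as a distribution, are Baradat2020 Thm. 2, not asserted here; ACLZ's dual
attainment / HJB form, ArnaudonEtAl2020 Cor. 11 & Thms. 23–24, is the smooth case).
[cite: Baradat2020, Thm. 2] -/
def HasBrodingerPressure (D : BrodingerProblem d) (P : Measure (TorusPath d D.t₀ D.t₁))
    (p : ℝ → UnitAddTorus d → ℝ) : Prop :=
  D.IsAdmissible P ∧ D.entropy P < ∞ ∧
    LocallyIntegrableOn (Function.uncurry p) (Ioo D.t₀ D.t₁ ×ˢ univ) ∧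
    ∀ (φ : ℝ → UnitAddTorus d → ℝ) (Q : Measure (TorusPath d D.t₀ D.t₁)),
      IsPressureTest D.t₀ D.t₁ φ → D.IsPerturbedFlow φ Q → D.entropy Q < ∞ →
        pressurePairing D.t₀ D.t₁ p φ ≤ 2 * D.ν * ((D.entropy Q).toReal - (D.entropy P).toReal)

variable {D : BrodingerProblem d} {P : Measure (TorusPath d D.t₀ D.t₁)} {p : ℝ → UnitAddTorus d → ℝ}

/-- **A flow carrying a Brödinger pressure is the Brödinger minimiser**: test the multiplier
inequality with `φ = 0` (KKT ⇒ optimality). [folklore] -/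
theorem HasBrodingerPressure.isBrodingerMinimiser (h : HasBrodingerPressure D P p) :
    IsBrodingerMinimiser D P where
  isAdmissible := h.1
  entropy_lt_top := h.2.1
  entropy_le Q hQ := by
    by_cases hQtop : D.entropy Q = ∞
    · exact hQtop ▸ le_top
    have hineq := h.2.2.2 0 Q (isPressureTest_zero D.t₀ D.t₁) ((D.isPerturbedFlow_zero_iff Q).2 hQ)
      (lt_top_iff_ne_top.2 hQtop)
    rw [show pressurePairing D.t₀ D.t₁ p 0 = 0 by simp [pressurePairing]] at hineq
    have hν : 0 < 2 * D.ν := by linarith [D.pos]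
    exact (ENNReal.toReal_le_toReal h.2.1.ne hQtop).1 (by nlinarith [hineq, hν])

/-- **Gauge freedom of the pressure**: adding a (continuous, say) function of time `c(t)` to a
Brödinger pressure gives another Brödinger pressure of the same flow (Baradat2020, Thm. 2:
"unique … up to adding a distribution only depending on time"). [cite: Baradat2020, Thm. 2] -/
theorem HasBrodingerPressure.add_time (h : HasBrodingerPressure D P p) {c : ℝ → ℝ}
    (hc : Continuous c) : HasBrodingerPressure D P fun t x => p t x + c t := by
  refine ⟨h.1, h.2.1, ?_, fun φ Q hφ hQ hQtop => ?_⟩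
  · have hc' : LocallyIntegrableOn (fun q : ℝ × UnitAddTorus d => c q.1) (Ioo D.t₀ D.t₁ ×ˢ univ) :=
      ((hc.comp continuous_fst).locallyIntegrable).locallyIntegrableOn _
    exact h.2.2.1.add hc'
  · rw [pressurePairing_add_time c hφ.integrable_apply hφ.integral_eq_zero]
    exact h.2.2.2 φ Q hφ hQ hQtop

/-- **Equilibrium has zero pressure**: the reversible Brownian law, as the (zero-entropy)
minimiser of the Brödinger problem with its own endpoint coupling
(`isBrodingerMinimiser_reversibleBrownianLaw`), carries the pressure `p = 0`. [folklore] -/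
theorem hasBrodingerPressure_reversibleBrownianLaw_zero (ν t₀ t₁ : ℝ) (pos : 0 < ν)
    (lt : t₀ < t₁) :
    HasBrodingerPressure (BrodingerProblem.ofPathMeasure ν t₀ t₁ pos lt
      (reversibleBrownianLaw d ν t₀ t₁)) (reversibleBrownianLaw d ν t₀ t₁) 0 := by
  have hmin := isBrodingerMinimiser_reversibleBrownianLaw (d := d) ν t₀ t₁ pos lt
  refine ⟨hmin.isAdmissible, hmin.entropy_lt_top,
    (locallyIntegrable_const (0 : ℝ)).locallyIntegrableOn _, fun φ Q _ _ _ => ?_⟩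
  have h0 : (BrodingerProblem.ofPathMeasure ν t₀ t₁ pos lt (reversibleBrownianLaw d ν t₀ t₁)).entropy
      (reversibleBrownianLaw d ν t₀ t₁) = 0 :=
    BrodingerProblem.entropy_reference _
  rw [show pressurePairing _ _ (0 : ℝ → UnitAddTorus d → ℝ) φ = 0 by simp [pressurePairing], h0,
    ENNReal.toReal_zero, sub_zero]
  exact mul_nonneg (mul_nonneg zero_le_two (BrodingerProblem.pos _).le) ENNReal.toReal_nonneg

end Literature.Analysis.FluidPDE
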